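import Mathlib
import Literature.Computability.Complexity.CNF
import Literature.Computability.Complexity.PNPWave0

/-!
# `SearchHardWindow` (crux stmt-PneNP-2460, route `OverlapGapAlgebra`): window boundaries of the
# `∃ (k, α)` and the role of the positive-satisfiability conjunct (negative-side support, cdisprove seat)

`SearchHardWindow` claims `∃ k α, PosSat k α ∧ Hard k α`: random `k`-SAT `F_k(n, ⌊α n⌋)` (literal
arrays `Φ : Fin m → Fin k → Fin n × Bool`) is satisfiable with uniformly positive probability AND
every polynomial-time word function solves it with probability `→ 0`.  This file does NOT refute
the crux (it is open in both directions: it implies `P ≠ NP` through the route's `closes`, and its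
negation at the intended witness would be a new algorithm).  It records, sorry-free and without
introducing any definition, which parameters can NOT witness the `∃` and why the first conjunct is
load-bearing:

* `hardness_false_of_nonpos`  — `α ≤ 0`: `m = 0`, the identity solves everything, `Hard` fails;
* `posSat_false_zero`         — `k = 0`, `α > 0`: an instance with an (empty) clause is never
  satisfiable, `PosSat` fails;
* `card_sat_le`, `satRatio_le` — FIRST MOMENT: `#{Φ satisfiable} ≤ 2^n ((2n)^k - n^k)^m`, i.e.
  `Pr[sat] ≤ 2^n (1 - 2^{-k})^m`;
* `posSat_false_of_firstMoment` — hence `2^k · log 2 ≤ α` (`k ≥ 1`) never witnesses;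
* `searchHardWindow_body_window` — every witness `(k, α)` of the body of `SearchHardWindow` has
  `1 ≤ k` and `0 < α < 2^k log 2` (so the crux is equivalent to its restriction to that window:
  `SearchHardWindow ↔ ∃ k α, (1 ≤ k ∧ 0 < α ∧ α < 2^k log 2) ∧ body k α`, one line from this);
* `lineA_density_needs_k_ge_23` — at the density `α_k = 5 · 2^k log k / k` of the route's items
  (`PositiveSatProbability`, `NoStableSection`) and of Line A of the crux chain, the crux body is
  false for every `k ≤ 22` (`k^5 ≥ 2^k` there puts `α_k` above the first-moment line), so any
  composition through that density runs at `k ≥ 23` (the tree's `positiveSatProbability_proof`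
  uses `k ≥ 1024`: consistent, and now visibly necessary up to the constant);
* `hardness_trivial_without_posSat` — with the positive-satisfiability conjunct DROPPED the
  remaining hardness conjunct is trivially satisfiable (`k = 0`, `α = 1`: nothing is solvable):
  the first conjunct is exactly what excludes the degenerate witnesses.

Refuter `refuter-cdisprove-stmt-PneNP-2460-0` (crux disprover), 2026-08-16; companion file
`Negative/FalseWithoutPolyTime.lean` (the time bound is load-bearing; the kernel stub of Line A is a
corollary of the hardness conjunct).  The statements are the literal sub-formulas of
`Summit.PneNP.PneNP.Theses.OverlapGapAlgebra.SearchHardWindow` (same binders, same `open scoped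
Classical` elaboration context), stated inline so that this file depends only on the Literature
vocabulary (`encodingCNF`, `IsPolyTime`) and not on the route file.
-/

-- `Summit.PneNP.PneNP.…` is the tree's mandated namespace (summit = sub-problem name).
set_option linter.dupNamespace false

noncomputable section

namespace Summit.PneNP.PneNP.Theorems.SearchHardWindow.Negative

open Finset Filter
open Literature.Computability.Complexity
open scoped Classical

/-! ## Counting: the first moment -/

/-- Size of the instance space: `#(Fin m → Fin k → Fin n × Bool) = ((2n)^k)^m`. -/
theorem card_inst (k n m : ℕ) :
    Fintype.card (Fin m → Fin k → Fin n × Bool) = ((2 * n) ^ k) ^ m := by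
  rw [Fintype.card_fun, Fintype.card_fun, Fintype.card_prod, Fintype.card_fin, Fintype.card_bool,
    Fintype.card_fin, Fintype.card_fin, mul_comm n 2]

/-- The literals falsified by an assignment `σ` are `n` in number (one per variable). -/
theorem card_falseLiterals (n : ℕ) (σ : Fin n → Bool) :
    (univ.filter fun l : Fin n × Bool => σ l.1 ≠ l.2).card = n := by
  have h : (univ.filter fun l : Fin n × Bool => σ l.1 ≠ l.2) = univ.image fun v => (v, !σ v) := by
    ext ⟨v, b⟩
    simp only [mem_filter, mem_univ, true_and, mem_image, Prod.mk.injEq]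
    constructor
    · intro hb
      exact ⟨v, rfl, by cases b <;> cases h : σ v <;> simp_all⟩
    · rintro ⟨v', hv, hb⟩
      rw [← hb, ← hv]
      cases σ v' <;> simp
  rw [h, card_image_of_injective _ (fun v v' hv => (Prod.mk.inj hv).1), card_univ, Fintype.card_fin]

/-- The clauses (`k`-tuples of literals) falsified by `σ` are `n^k` in number. -/
theorem card_falseClauses (k n : ℕ) (σ : Fin n → Bool) :
    (univ.filter fun c : Fin k → Fin n × Bool => ∀ j, σ (c j).1 ≠ (c j).2).card = n ^ k := by
  have h : (univ.filter fun c : Fin k → Fin n × Bool => ∀ j, σ (c j).1 ≠ (c j).2) =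
      Fintype.piFinset fun _ : Fin k => univ.filter fun l : Fin n × Bool => σ l.1 ≠ l.2 := by
    ext c
    simp [Fintype.mem_piFinset]
  rw [h, Fintype.card_piFinset, prod_const, card_falseLiterals, card_univ, Fintype.card_fin]

/-- The clauses satisfied by `σ` are `(2n)^k - n^k` in number. -/
theorem card_trueClauses (k n : ℕ) (σ : Fin n → Bool) :
    (univ.filter fun c : Fin k → Fin n × Bool => ∃ j, σ (c j).1 = (c j).2).card =
      (2 * n) ^ k - n ^ k := by
  have htot : (univ : Finset (Fin k → Fin n × Bool)).card = (2 * n) ^ k := by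
    rw [card_univ, Fintype.card_fun, Fintype.card_prod, Fintype.card_fin, Fintype.card_bool,
      Fintype.card_fin, mul_comm]
  have hsplit := Finset.card_filter_add_card_filter_not
    (s := (univ : Finset (Fin k → Fin n × Bool))) (p := fun c => ∃ j, σ (c j).1 = (c j).2)
  have hneg : (univ.filter fun c : Fin k → Fin n × Bool => ¬ ∃ j, σ (c j).1 = (c j).2).card =
      n ^ k := by
    rw [← card_falseClauses k n σ]
    congr 1
    ext c
    simp
  rw [hneg, htot] at hsplit
  omega

/-- The instances satisfied by a FIXED assignment `σ` are `((2n)^k - n^k)^m` in number. -/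
theorem card_satBy (k n m : ℕ) (σ : Fin n → Bool) :
    (univ.filter fun Φ : Fin m → Fin k → Fin n × Bool =>
        ∀ i, ∃ j, σ (Φ i j).1 = (Φ i j).2).card = ((2 * n) ^ k - n ^ k) ^ m := by
  have h : (univ.filter fun Φ : Fin m → Fin k → Fin n × Bool => ∀ i, ∃ j, σ (Φ i j).1 = (Φ i j).2) =
      Fintype.piFinset fun _ : Fin m => univ.filter fun c : Fin k → Fin n × Bool =>
        ∃ j, σ (c j).1 = (c j).2 := by
    ext Φ
    simp [Fintype.mem_piFinset]
  rw [h, Fintype.card_piFinset, prod_const, card_trueClauses, card_univ, Fintype.card_fin]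

/-- FIRST MOMENT (union bound over the `2^n` assignments):
`#{Φ satisfiable} ≤ 2^n · ((2n)^k - n^k)^m`. [folklore] -/
theorem card_sat_le (k n m : ℕ) :
    (univ.filter fun Φ : Fin m → Fin k → Fin n × Bool =>
        ∃ σ : Fin n → Bool, ∀ i, ∃ j, σ (Φ i j).1 = (Φ i j).2).card ≤
      2 ^ n * ((2 * n) ^ k - n ^ k) ^ m := by
  calc (univ.filter fun Φ : Fin m → Fin k → Fin n × Bool =>
          ∃ σ : Fin n → Bool, ∀ i, ∃ j, σ (Φ i j).1 = (Φ i j).2).card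
      ≤ ((univ : Finset (Fin n → Bool)).biUnion fun σ => univ.filter
          fun Φ : Fin m → Fin k → Fin n × Bool => ∀ i, ∃ j, σ (Φ i j).1 = (Φ i j).2).card := by
        refine card_le_card fun Φ hΦ => ?_
        simp only [mem_filter, mem_univ, true_and, mem_biUnion] at hΦ ⊢
        obtain ⟨σ, hσ⟩ := hΦ
        exact ⟨σ, hσ⟩
    _ ≤ ∑ σ : Fin n → Bool, (univ.filter
          fun Φ : Fin m → Fin k → Fin n × Bool => ∀ i, ∃ j, σ (Φ i j).1 = (Φ i j).2).card :=
        card_biUnion_le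
    _ = 2 ^ n * ((2 * n) ^ k - n ^ k) ^ m := by
        simp only [card_satBy, sum_const, card_univ, Fintype.card_fun, Fintype.card_bool,
          Fintype.card_fin, smul_eq_mul]

/-- FIRST-MOMENT BOUND on the satisfaction probability of `F_k(n, m)` (the route's counting ratio):
`Pr[sat] ≤ 2^n · (1 - 2^{-k})^m` for `n ≥ 1`. [folklore] -/
theorem satRatio_le (k : ℕ) {n : ℕ} (hn : 1 ≤ n) (m : ℕ) :
    ((univ.filter fun Φ : Fin m → Fin k → Fin n × Bool =>
        ∃ σ : Fin n → Bool, ∀ i, ∃ j, σ (Φ i j).1 = (Φ i j).2).card : ℝ) /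
      Fintype.card (Fin m → Fin k → Fin n × Bool) ≤ 2 ^ n * (1 - (1 / 2 : ℝ) ^ k) ^ m := by
  have hn' : (0 : ℝ) < n := by exact_mod_cast hn
  have hΩ : (Fintype.card (Fin m → Fin k → Fin n × Bool) : ℝ) = ((2 * (n : ℝ)) ^ k) ^ m := by
    rw [card_inst]; push_cast; ring
  have hΩpos : (0 : ℝ) < ((2 * (n : ℝ)) ^ k) ^ m := by positivity
  rw [hΩ, div_le_iff₀ hΩpos]
  have hle : n ^ k ≤ (2 * n) ^ k := Nat.pow_le_pow_left (by omega) k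
  have hq : ((2 * (n : ℝ)) ^ k - (n : ℝ) ^ k) = (1 - (1 / 2 : ℝ) ^ k) * (2 * (n : ℝ)) ^ k := by
    rw [sub_mul, one_mul, ← mul_pow]
    ring
  calc ((univ.filter fun Φ : Fin m → Fin k → Fin n × Bool =>
          ∃ σ : Fin n → Bool, ∀ i, ∃ j, σ (Φ i j).1 = (Φ i j).2).card : ℝ)
      ≤ ((2 ^ n * ((2 * n) ^ k - n ^ k) ^ m : ℕ) : ℝ) := by exact_mod_cast card_sat_le k n m
    _ = 2 ^ n * ((2 * (n : ℝ)) ^ k - (n : ℝ) ^ k) ^ m := by push_cast [Nat.cast_sub hle]; ring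
    _ = 2 ^ n * (1 - (1 / 2 : ℝ) ^ k) ^ m * ((2 * (n : ℝ)) ^ k) ^ m := by rw [hq, mul_pow]; ring

/-- Along `m = ⌊α n⌋₊` with `α ≥ 2^k log 2` (`k ≥ 1`) the satisfaction probability is eventually
below any `ε > 0` (`2^n (1 - 2^{-k})^{αn-1} = q⁻¹ (2 q^α)^n`, `2 q^α < 2 e^{-2^{-k} α} ≤ 1`). [folklore] -/
theorem satRatio_eventually_lt (k : ℕ) (hk : 1 ≤ k) {α : ℝ} (hα : 2 ^ k * Real.log 2 ≤ α)
    {ε : ℝ} (hε : 0 < ε) :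
    ∀ᶠ n : ℕ in atTop, ((univ.filter fun Φ : Fin ⌊α * n⌋₊ → Fin k → Fin n × Bool =>
        ∃ σ : Fin n → Bool, ∀ i, ∃ j, σ (Φ i j).1 = (Φ i j).2).card : ℝ) /
      Fintype.card (Fin ⌊α * n⌋₊ → Fin k → Fin n × Bool) < ε := by
  set q : ℝ := 1 - (1 / 2 : ℝ) ^ k with hqdef
  have hhalf : (1 / 2 : ℝ) ^ k ≤ 1 / 2 := by
    calc (1 / 2 : ℝ) ^ k ≤ (1 / 2 : ℝ) ^ 1 := pow_le_pow_of_le_one (by norm_num) (by norm_num) hk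
      _ = 1 / 2 := pow_one _
  have hhalfpos : (0 : ℝ) < (1 / 2 : ℝ) ^ k := by positivity
  have hq0 : 0 < q := by rw [hqdef]; linarith
  have hq1 : q < 1 := by rw [hqdef]; linarith
  have hlog2 : 0 < Real.log 2 := Real.log_pos (by norm_num)
  have hαpos : 0 < α := lt_of_lt_of_le (by positivity) hα
  have hqexp : q < Real.exp (-(1 / 2 : ℝ) ^ k) := by
    have := Real.add_one_lt_exp (x := -(1 / 2 : ℝ) ^ k) (by linarith)
    rw [hqdef]; linarith
  have hqα : q ^ α < 1 / 2 := by
    have h1 : q ^ α < (Real.exp (-(1 / 2 : ℝ) ^ k)) ^ α := Real.rpow_lt_rpow hq0.le hqexp hαpos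
    have h2 : (Real.exp (-(1 / 2 : ℝ) ^ k)) ^ α = Real.exp (-(1 / 2 : ℝ) ^ k * α) := by
      rw [← Real.exp_mul]
    have h3 : -(1 / 2 : ℝ) ^ k * α ≤ -Real.log 2 := by
      have h4 : (1 / 2 : ℝ) ^ k * (2 ^ k * Real.log 2) ≤ (1 / 2 : ℝ) ^ k * α :=
        mul_le_mul_of_nonneg_left hα hhalfpos.le
      have h5 : (1 / 2 : ℝ) ^ k * (2 ^ k * Real.log 2) = Real.log 2 := by
        rw [← mul_assoc, ← mul_pow]; norm_num
      linarith
    have h6 : Real.exp (-(1 / 2 : ℝ) ^ k * α) ≤ 1 / 2 := by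
      calc Real.exp (-(1 / 2 : ℝ) ^ k * α) ≤ Real.exp (-Real.log 2) := Real.exp_le_exp.2 h3
        _ = 1 / 2 := by rw [Real.exp_neg, Real.exp_log (by norm_num)]; norm_num
    linarith [h1.trans_le (h2 ▸ h6)]
  set r : ℝ := 2 * q ^ α with hrdef
  have hr0 : 0 ≤ r := by rw [hrdef]; positivity
  have hr1 : r < 1 := by rw [hrdef]; linarith
  have hlim : Tendsto (fun n : ℕ => r ^ n / q) atTop (nhds 0) := by
    simpa using (tendsto_pow_atTop_nhds_zero_of_lt_one hr0 hr1).div_const q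
  have hsmall : ∀ᶠ n : ℕ in atTop, r ^ n / q < ε := (tendsto_order.1 hlim).2 ε hε
  filter_upwards [hsmall, eventually_ge_atTop 1] with n hn hn1
  have hb := satRatio_le k hn1 ⌊α * n⌋₊
  have hm : α * n - 1 ≤ (⌊α * n⌋₊ : ℝ) := by linarith [Nat.lt_floor_add_one (α * n)]
  have hpow : q ^ ⌊α * n⌋₊ ≤ q ^ (α * n - 1) := by
    rw [← Real.rpow_natCast]
    exact Real.rpow_le_rpow_of_exponent_ge hq0 hq1.le hm
  have hsplit : q ^ (α * n - 1) = (q ^ α) ^ n / q := by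
    rw [Real.rpow_sub_one hq0.ne', Real.rpow_mul_natCast hq0.le]
  have h2n : (0 : ℝ) ≤ 2 ^ n := by positivity
  calc _ ≤ 2 ^ n * q ^ ⌊α * n⌋₊ := hb
    _ ≤ 2 ^ n * q ^ (α * n - 1) := mul_le_mul_of_nonneg_left hpow h2n
    _ = r ^ n / q := by rw [hsplit, hrdef, mul_pow]; ring
    _ < ε := hn

/-! ## Which `(k, α)` cannot witness `SearchHardWindow` -/

/-- UPPER EDGE: for `k ≥ 1` and `α ≥ 2^k · log 2` the positive-satisfiability conjunct of
`SearchHardWindow` fails (first moment). [folklore] -/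
theorem posSat_false_of_firstMoment (k : ℕ) (hk : 1 ≤ k) {α : ℝ} (hα : 2 ^ k * Real.log 2 ≤ α) :
    ¬ ∃ ε : ℝ, 0 < ε ∧ ∀ᶠ n : ℕ in Filter.atTop, ∀ m : ℕ, m = ⌊α * n⌋₊ → ε ≤
      ((Finset.univ.filter fun Φ : Fin m → Fin k → Fin n × Bool =>
        ∃ σ : Fin n → Bool, ∀ i, ∃ j, σ (Φ i j).1 = (Φ i j).2).card : ℝ) /
        Fintype.card (Fin m → Fin k → Fin n × Bool) := by
  rintro ⟨ε, hε, hev⟩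
  obtain ⟨n, hn1, hn2⟩ := (hev.and (satRatio_eventually_lt k hk hα hε)).exists
  have := hn1 _ rfl
  linarith

/-- For `α > 0` the clause number `⌊α n⌋₊` is eventually positive. -/
theorem eventually_one_le_floor {α : ℝ} (hα : 0 < α) : ∀ᶠ n : ℕ in atTop, 1 ≤ ⌊α * n⌋₊ := by
  refine Filter.eventually_atTop.2 ⟨⌈1 / α⌉₊, fun n hn => Nat.le_floor ?_⟩
  have h1 : (1 / α : ℝ) ≤ n := le_trans (Nat.le_ceil _) (by exact_mod_cast hn)
  rw [div_le_iff₀ hα] at h1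
  have h2 : 1 ≤ α * n := by linarith [mul_comm α n]
  exact_mod_cast h2

/-- `k = 0`, `α > 0`: eventually `m ≥ 1` and an instance with an empty clause is unsatisfiable,
so the positive-satisfiability conjunct fails. -/
theorem posSat_false_zero {α : ℝ} (hα : 0 < α) :
    ¬ ∃ ε : ℝ, 0 < ε ∧ ∀ᶠ n : ℕ in Filter.atTop, ∀ m : ℕ, m = ⌊α * n⌋₊ → ε ≤
      ((Finset.univ.filter fun Φ : Fin m → Fin 0 → Fin n × Bool =>
        ∃ σ : Fin n → Bool, ∀ i, ∃ j, σ (Φ i j).1 = (Φ i j).2).card : ℝ) /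
        Fintype.card (Fin m → Fin 0 → Fin n × Bool) := by
  rintro ⟨ε, hε, hev⟩
  obtain ⟨n, hn1, hn2⟩ := (hev.and (eventually_one_le_floor hα)).exists
  have h := hn1 _ rfl
  rw [Finset.filter_false_of_mem, Finset.card_empty] at h
  · simp only [Nat.cast_zero, zero_div] at h
    linarith
  · rintro Φ - ⟨σ, hσ⟩
    obtain ⟨j, -⟩ := hσ ⟨0, hn2⟩
    exact j.elim0

/-- LOWER EDGE: for `α ≤ 0` the clause number `⌊α n⌋₊` is `0`, the identity (polynomial-time,
Mathlib's `Turing.idComputableInPolyTime`) solves every instance, and the hardness conjunct of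
`SearchHardWindow` fails. -/
theorem hardness_false_of_nonpos (k : ℕ) {α : ℝ} (hα : α ≤ 0) :
    ¬ ∀ f : List Bool → List Bool, Literature.Computability.Complexity.IsPolyTime f → ∀ ε : ℝ,
      0 < ε → ∀ᶠ n : ℕ in Filter.atTop, ∀ m : ℕ, m = ⌊α * n⌋₊ →
      ((Finset.univ.filter fun Φ : Fin m → Fin k → Fin n × Bool => ∀ i, ∃ j,
        (f (Literature.Computability.Complexity.encodingCNF.encode (List.ofFn fun a =>
          List.ofFn fun b => (((Φ a b).1 : ℕ), (Φ a b).2)))).getD (Φ i j).1 false =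
            (Φ i j).2).card : ℝ) / Fintype.card (Fin m → Fin k → Fin n × Bool) ≤ ε := by
  intro h
  have hid : IsPolyTime (id : List Bool → List Bool) := ⟨Turing.idComputableInPolyTime _⟩
  obtain ⟨n, hn⟩ := (h id hid (1 / 2) (by norm_num)).exists
  have hm : ⌊α * n⌋₊ = 0 := Nat.floor_of_nonpos (by nlinarith [(Nat.cast_nonneg n : (0 : ℝ) ≤ n)])
  have := hn 0 hm.symm
  rw [Finset.filter_true_of_mem (fun Φ _ i => i.elim0), Finset.card_univ] at this
  norm_num at this

/-- THE WINDOW: every witness `(k, α)` of the body of `SearchHardWindow` has `1 ≤ k` and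
`0 < α < 2^k · log 2`. -/
theorem searchHardWindow_body_window {k : ℕ} {α : ℝ}
    (h : (∃ ε : ℝ, 0 < ε ∧ ∀ᶠ n : ℕ in Filter.atTop, ∀ m : ℕ, m = ⌊α * n⌋₊ → ε ≤
      ((Finset.univ.filter fun Φ : Fin m → Fin k → Fin n × Bool =>
        ∃ σ : Fin n → Bool, ∀ i, ∃ j, σ (Φ i j).1 = (Φ i j).2).card : ℝ) /
        Fintype.card (Fin m → Fin k → Fin n × Bool)) ∧
      ∀ f : List Bool → List Bool, Literature.Computability.Complexity.IsPolyTime f → ∀ ε : ℝ,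
      0 < ε → ∀ᶠ n : ℕ in Filter.atTop, ∀ m : ℕ, m = ⌊α * n⌋₊ →
      ((Finset.univ.filter fun Φ : Fin m → Fin k → Fin n × Bool => ∀ i, ∃ j,
        (f (Literature.Computability.Complexity.encodingCNF.encode (List.ofFn fun a =>
          List.ofFn fun b => (((Φ a b).1 : ℕ), (Φ a b).2)))).getD (Φ i j).1 false =
            (Φ i j).2).card : ℝ) / Fintype.card (Fin m → Fin k → Fin n × Bool) ≤ ε) :
    1 ≤ k ∧ 0 < α ∧ α < 2 ^ k * Real.log 2 := by
  obtain ⟨hsat, hhard⟩ := h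
  have hα : 0 < α := by
    by_contra hα
    exact hardness_false_of_nonpos k (not_lt.1 hα) hhard
  have hk : 1 ≤ k := by
    rcases Nat.eq_zero_or_pos k with rfl | hk
    · exact absurd hsat (posSat_false_zero hα)
    · exact hk
  refine ⟨hk, hα, ?_⟩
  by_contra hα'
  exact posSat_false_of_firstMoment k hk (not_lt.1 hα') hsat

/-- `2^k ≤ k^5` for `2 ≤ k ≤ 22` (it fails from `k = 23` on). -/
theorem two_pow_le_pow_five {k : ℕ} (h2 : 2 ≤ k) (h22 : k ≤ 22) : 2 ^ k ≤ k ^ 5 := by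
  interval_cases k <;> norm_num

/-- LINE A / THE ROUTE'S DENSITY NEEDS `k ≥ 23`: if `(k, 5 · 2^k log k / k)` witnesses the body of
`SearchHardWindow` then `23 ≤ k` (`k = 0, 1`: the density is `0`; `2 ≤ k ≤ 22`: it is
`≥ 2^k log 2`). -/
theorem lineA_density_needs_k_ge_23 {k : ℕ}
    (h : (∃ ε : ℝ, 0 < ε ∧ ∀ᶠ n : ℕ in Filter.atTop, ∀ m : ℕ,
      m = ⌊5 * 2 ^ k * Real.log k / k * n⌋₊ → ε ≤
      ((Finset.univ.filter fun Φ : Fin m → Fin k → Fin n × Bool =>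
        ∃ σ : Fin n → Bool, ∀ i, ∃ j, σ (Φ i j).1 = (Φ i j).2).card : ℝ) /
        Fintype.card (Fin m → Fin k → Fin n × Bool)) ∧
      ∀ f : List Bool → List Bool, Literature.Computability.Complexity.IsPolyTime f → ∀ ε : ℝ,
      0 < ε → ∀ᶠ n : ℕ in Filter.atTop, ∀ m : ℕ, m = ⌊5 * 2 ^ k * Real.log k / k * n⌋₊ →
      ((Finset.univ.filter fun Φ : Fin m → Fin k → Fin n × Bool => ∀ i, ∃ j,
        (f (Literature.Computability.Complexity.encodingCNF.encode (List.ofFn fun a =>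
          List.ofFn fun b => (((Φ a b).1 : ℕ), (Φ a b).2)))).getD (Φ i j).1 false =
            (Φ i j).2).card : ℝ) / Fintype.card (Fin m → Fin k → Fin n × Bool) ≤ ε) :
    23 ≤ k := by
  obtain ⟨hk1, hα, hlt⟩ := searchHardWindow_body_window h
  by_contra hk
  have hk22 : k ≤ 22 := by omega
  rcases Nat.lt_or_ge k 2 with h2 | h2
  · have : 5 * 2 ^ k * Real.log k / k ≤ 0 := by interval_cases k; simp
    linarith
  · have hkpos : (0 : ℝ) < k := by exact_mod_cast (show 0 < k by omega)
    have hnat : (2 : ℝ) ^ k ≤ (k : ℝ) ^ 5 := by exact_mod_cast two_pow_le_pow_five h2 hk22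
    have hlog : Real.log ((2 : ℝ) ^ k) ≤ Real.log ((k : ℝ) ^ 5) :=
      Real.log_le_log (by positivity) hnat
    rw [Real.log_pow, Real.log_pow] at hlog
    push_cast at hlog
    rw [div_lt_iff₀ hkpos] at hlt
    have h2k : (0 : ℝ) < 2 ^ k := by positivity
    nlinarith

/-! ## The positive-satisfiability conjunct is load-bearing -/

/-- With the first conjunct DROPPED, the hardness conjunct of `SearchHardWindow` is trivially
satisfiable: at `k = 0`, `α = 1` (`m = n ≥ 1`) no word function solves any instance. -/
theorem hardness_trivial_without_posSat : ∃ (k : ℕ) (α : ℝ),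
    ∀ f : List Bool → List Bool, Literature.Computability.Complexity.IsPolyTime f → ∀ ε : ℝ,
      0 < ε → ∀ᶠ n : ℕ in Filter.atTop, ∀ m : ℕ, m = ⌊α * n⌋₊ →
      ((Finset.univ.filter fun Φ : Fin m → Fin k → Fin n × Bool => ∀ i, ∃ j,
        (f (Literature.Computability.Complexity.encodingCNF.encode (List.ofFn fun a =>
          List.ofFn fun b => (((Φ a b).1 : ℕ), (Φ a b).2)))).getD (Φ i j).1 false =
            (Φ i j).2).card : ℝ) / Fintype.card (Fin m → Fin k → Fin n × Bool) ≤ ε := by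
  refine ⟨0, 1, fun f _ ε hε => Filter.eventually_atTop.2 ⟨1, fun n hn m hm => ?_⟩⟩
  have hm' : m = n := by rw [hm, one_mul, Nat.floor_natCast]
  rw [Finset.filter_false_of_mem, Finset.card_empty]
  · simp only [Nat.cast_zero, zero_div]
    exact hε.le
  · rintro Φ - hΦ
    obtain ⟨j, -⟩ := hΦ ⟨0, by omega⟩
    exact j.elim0

end Summit.PneNP.PneNP.Theorems.SearchHardWindow.Negative

end
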